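import Summits.QuantumFields.YangMills.Theorems.BalabanUVNodesN15KingModelBlockAveragedFreePropagator

/-!
# BalabanUVNodes ∕ N15 — THE KING-MODEL RUNG (PART Ϻ-j): THE PROPER-TIME PROPAGATOR IN ONE DIMENSION IS THE ORNSTEIN–UHLENBECK COVARIANCE —
# `C_m^{(1)}(R) = ∫₀^∞ e^{−tm²}(4πt)^{−1∕2}e^{−R²∕4t}dt = e^{−m|R|}∕(2m)`, and `S₂^{ℝ}(z) = ∫₀¹∫₀¹ e^{−m|z+a−b|}∕(2m)db da` for EVERY `z ∈ ℤ` (part Ϸ-q had `z ≥ 1`)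
# (Track A, DAG node N15 = NE2; FAN-OUT v1.1 §N15 s3 «KING-MODEL RUNG»; uses parts Ϻ-a∕c∕i and Ϸ-i's Lorentzian cosine integral; count-neutral)

HONEST FRAMING.  Count-neutral (cell `pub-ymgap`, seat `pub-ymgap-dag-n15-e` g35; `--supports stmt-QuantumFields-27366 --as helper` = K3⁸).  King's `A = 0`, `g = 0` model
([King1986] C. King, Commun. Math. Phys. **102** (1986) 649–677).  A CONSISTENCY CHECK on part Ϻ-c's proper-time propagator `freePropRadial d m² R` in the one case with an
elementary closed form, `d+1 = 1`: writing the line heat kernel as a cosine transform (`g_t(R) = (2π)⁻¹∫cos(Rq)e^{−tq²}dq`, the tree's `integral_cos_mul_gaussian`),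
exchanging with the proper-time integral (Fubini, majorant `|cos(Rq)|∕(q²+m²)`), summing the proper time (`∫₀^∞e^{−t(q²+m²)}dt = (q²+m²)⁻¹`) and evaluating the Lorentzian
cosine integral (part Ϸ-i's `integral_cos_div_sq_add_sq`, `= πe^{−m|R|}∕m`): ★★ `C_m^{(1)}(R) = e^{−m|R|}∕(2m)` — the two-sided exponential (Ornstein–Uhlenbeck) covariance
`(−d²∕dx² + m²)⁻¹`.  With part Ϻ-i's block-average form this extends part Ϸ-q's one-dimensional position-space check to EVERY integer separation (there `z ≥ 1`; now
also `z = 0`, where `S₂^{ℝ}(0) = (m−1+e^{−m})∕m³` by part Ϸ-p): ★★ `S₂^{ℝ}(z) = ∫_{(0,1]}∫_{(0,1]} e^{−m|z+a−b|}∕(2m)db da`.  NOT Bałaban's objects; NOT a node discharge;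
nothing continuum-Yang–Mills ∕ `ℝ⁴` ∕ OS ∕ Clay.  0 `sorry`, 0 def; standard axioms.

WHAT THIS FILE PROVES (kernel).  §1 `heatRadial_zero_eq_gaussLine`, `sqrt_pi_div_eq`, ★ `gaussLine_eq_integral_cos` (the heat kernel as a cosine transform), `integrable_oneDim_uncurry` (Fubini's
hypothesis on `(0,∞) × ℝ`), ★★ **`freePropRadial_dim_one`** (`= e^{−√m²|R|}∕(2√m²)`).  §2 ★★ **`kingS2Inf_dim_one_eq_blockAverage_ou`** (every `z : Fin 1 → ℤ`; blocks in `Fin 1 → ℝ` form).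

HONEST SCOPE.  `d+1 = 1` only (higher odd dimensions have Bessel∕Yukawa closed forms, not typed).  N15 untouched; counts unmoved.  Locators (use): [King1986] Thm 2.1 (2.22) p.654,
(4.5) p.670, (4.36) p.674; [ButzerNessel1971] Problem 5.1.2.
-/

noncomputable section

open scoped BigOperators Topology
open Filter MeasureTheory Set Function

namespace Summit.QuantumFields.YangMills.BalabanUVNodes.N15KingModelRung.ProperTime

open Summit.QuantumFields.YangMills.BalabanUVNodes.N15KingModelRung.OptimalDecay

/-! ## §1 `C_m^{(1)}(R) = e^{−m|R|}∕(2m)` -/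

/-- In one dimension the radial heat kernel is the line heat kernel: `k_t(R) = g_t(R)` (`d = 0`). [folklore] -/
theorem heatRadial_zero_eq_gaussLine (t R : ℝ) : heatRadial 0 t R = gaussLine t R := by
  simp [heatRadial, gaussLine]

/-- `√(π∕t) = 2π·(4πt)^{−1∕2}` (`t > 0`). [folklore] -/
theorem sqrt_pi_div_eq {t : ℝ} (ht : 0 < t) : Real.sqrt (Real.pi / t) = 2 * Real.pi * (Real.sqrt (4 * Real.pi * t))⁻¹ := by
  have hπ := Real.pi_pos
  have hs : 0 < Real.sqrt (4 * Real.pi * t) := Real.sqrt_pos.mpr (by positivity)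
  rw [eq_mul_inv_iff_mul_eq₀ hs.ne', ← Real.sqrt_mul (by positivity)]
  rw [show Real.pi / t * (4 * Real.pi * t) = (2 * Real.pi) ^ 2 by field_simp; ring]
  exact Real.sqrt_sq (by positivity)

/-- ★ **The heat kernel as a cosine transform**: `g_t(R) = (2π)⁻¹∫_ℝ cos(Rq)e^{−tq²}dq` (`t > 0`; the tree's `integral_cos_mul_gaussian`). [folklore] -/
theorem gaussLine_eq_integral_cos {t : ℝ} (ht : 0 < t) (R : ℝ) :
    gaussLine t R = (2 * Real.pi)⁻¹ * ∫ q : ℝ, Real.cos (R * q) * Real.exp (-t * q ^ 2) := by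
  rw [Literature.MathematicalPhysics.QuantumLattice.integral_cos_mul_gaussian ht R, sqrt_pi_div_eq ht, gaussLine]
  have hπ : (2 * Real.pi) ≠ 0 := by positivity
  field_simp

/-- Fubini's hypothesis: `(t,q) ↦ (2π)⁻¹cos(Rq)e^{−t(q²+m²)}` is integrable on `(0,∞) × ℝ` (the `q`-slices of the norm integrate to `(2π)⁻¹|cos(Rq)|∕(q²+m²)`). [folklore] -/
theorem integrable_oneDim_uncurry {m2 : ℝ} (hm : 0 < m2) (R : ℝ) :
    Integrable (uncurry fun (t q : ℝ) => (2 * Real.pi)⁻¹ * (Real.cos (R * q) * Real.exp (-(t * (q ^ 2 + m2)))))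
      ((volume.restrict (Ioi (0 : ℝ))).prod volume) := by
  have hmeas : AEStronglyMeasurable (uncurry fun (t q : ℝ) => (2 * Real.pi)⁻¹ * (Real.cos (R * q) * Real.exp (-(t * (q ^ 2 + m2)))))
      ((volume.restrict (Ioi (0 : ℝ))).prod volume) := by
    refine Continuous.aestronglyMeasurable ?_
    have : (uncurry fun (t q : ℝ) => (2 * Real.pi)⁻¹ * (Real.cos (R * q) * Real.exp (-(t * (q ^ 2 + m2)))))
        = fun p : ℝ × ℝ => (2 * Real.pi)⁻¹ * (Real.cos (R * p.2) * Real.exp (-(p.1 * (p.2 ^ 2 + m2)))) := by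
      funext p; rfl
    rw [this]; fun_prop
  rw [integrable_prod_iff' hmeas]
  constructor
  · refine Eventually.of_forall fun q => ?_
    have hc : 0 < q ^ 2 + m2 := by positivity
    have hE : IntegrableOn (fun t : ℝ => Real.exp (-(q ^ 2 + m2) * t)) (Ioi (0 : ℝ)) := exp_neg_integrableOn_Ioi 0 hc
    refine (hE.const_mul ((2 * Real.pi)⁻¹ * Real.cos (R * q))).congr (Eventually.of_forall fun t => ?_)
    simp only [Function.uncurry_apply_pair]
    rw [show -(q ^ 2 + m2) * t = -(t * (q ^ 2 + m2)) by ring]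
    ring
  · have hM : 0 < Real.sqrt m2 := Real.sqrt_pos.mpr hm
    have hsq : Real.sqrt m2 ^ 2 = m2 := Real.sq_sqrt hm.le
    have hval : ∀ q : ℝ, ∫ t in Ioi (0 : ℝ), ‖(2 * Real.pi)⁻¹ * (Real.cos (R * q) * Real.exp (-(t * (q ^ 2 + m2))))‖
        = (2 * Real.pi)⁻¹ * |Real.cos (q * R) / (q ^ 2 + Real.sqrt m2 ^ 2)| := by
      intro q
      have hc : 0 < q ^ 2 + m2 := by positivity
      have hpt : (fun t : ℝ => ‖(2 * Real.pi)⁻¹ * (Real.cos (R * q) * Real.exp (-(t * (q ^ 2 + m2))))‖)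
          = fun t => (2 * Real.pi)⁻¹ * |Real.cos (R * q)| * Real.exp (-(t * (q ^ 2 + m2))) := by
        funext t
        rw [Real.norm_eq_abs, abs_mul, abs_mul, abs_of_pos (by positivity : (0 : ℝ) < (2 * Real.pi)⁻¹), Real.abs_exp]
        ring
      rw [hpt, integral_const_mul, ← inv_eq_integral_exp_Ioi hc, hsq, abs_div, abs_of_pos hc, mul_comm q R]
      ring
    refine (((integrable_cos_div_sq_add_sq hM R).abs.const_mul ((2 * Real.pi)⁻¹))).congr (Eventually.of_forall fun q => ?_)
    simp only [Function.uncurry_apply_pair]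
    exact (hval q).symm

/-- ★★ **THE ONE-DIMENSIONAL PROPER-TIME PROPAGATOR IS THE ORNSTEIN–UHLENBECK COVARIANCE**: for `m² > 0` and every real `R`,
`C_m^{(1)}(R) = ∫₀^∞e^{−tm²}(4πt)^{−1∕2}e^{−R²∕4t}dt = e^{−√m²|R|}∕(2√m²)`. [cite: ButzerNessel1971, Problem 5.1.2; folklore] -/
theorem freePropRadial_dim_one {m2 : ℝ} (hm : 0 < m2) (R : ℝ) : freePropRadial 0 m2 R = Real.exp (-(Real.sqrt m2 * |R|)) / (2 * Real.sqrt m2) := by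
  have hM : 0 < Real.sqrt m2 := Real.sqrt_pos.mpr hm
  have hsq : Real.sqrt m2 ^ 2 = m2 := Real.sq_sqrt hm.le
  -- Step 1: insert the cosine transform of the heat kernel and merge the exponentials
  have h1 : freePropRadial 0 m2 R = ∫ t in Ioi (0 : ℝ), ∫ q : ℝ, (2 * Real.pi)⁻¹ * (Real.cos (R * q) * Real.exp (-(t * (q ^ 2 + m2)))) := by
    unfold freePropRadial
    refine setIntegral_congr_fun measurableSet_Ioi fun t ht => ?_
    have ht : 0 < t := ht
    rw [heatRadial_zero_eq_gaussLine, gaussLine_eq_integral_cos ht, ← mul_assoc, mul_comm (Real.exp _), mul_assoc, ← integral_const_mul, ← integral_const_mul]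
    refine integral_congr_ae (Eventually.of_forall fun q => ?_)
    simp only
    rw [show -(t * (q ^ 2 + m2)) = -t * q ^ 2 + -(t * m2) by ring, Real.exp_add]
    ring
  -- Step 2: Fubini and the proper-time sum
  rw [h1, integral_integral_swap (integrable_oneDim_uncurry hm R)]
  have h2 : ∀ q : ℝ, ∫ t in Ioi (0 : ℝ), (2 * Real.pi)⁻¹ * (Real.cos (R * q) * Real.exp (-(t * (q ^ 2 + m2))))
      = (2 * Real.pi)⁻¹ * (Real.cos (q * R) / (q ^ 2 + Real.sqrt m2 ^ 2)) := by
    intro q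
    have hc : 0 < q ^ 2 + m2 := by positivity
    have hpt : (fun t : ℝ => (2 * Real.pi)⁻¹ * (Real.cos (R * q) * Real.exp (-(t * (q ^ 2 + m2)))))
        = fun t => (2 * Real.pi)⁻¹ * Real.cos (R * q) * Real.exp (-(t * (q ^ 2 + m2))) := by
      funext t; ring
    rw [hpt, integral_const_mul, ← inv_eq_integral_exp_Ioi hc, hsq, mul_comm q R, div_eq_mul_inv]
    ring
  simp_rw [h2]
  -- Step 3: the Lorentzian cosine integral
  rw [integral_const_mul, integral_cos_div_sq_add_sq hM R]
  have hπ : Real.pi ≠ 0 := Real.pi_pos.ne'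
  field_simp

/-- `C_m^{(1)}(R) > 0` in closed form (consistency with part Ϻ-c's `freePropRadial_pos` off `R = 0`; here also at `R = 0`). [folklore] -/
theorem freePropRadial_dim_one_pos {m2 : ℝ} (hm : 0 < m2) (R : ℝ) : 0 < freePropRadial 0 m2 R := by
  rw [freePropRadial_dim_one hm]
  have := Real.sqrt_pos.mpr hm
  positivity

/-! ## §2 King's `d+1 = 1` block two-point function at EVERY separation -/

/-- ★★ **THE ONE-DIMENSIONAL POSITION-SPACE FORM AT EVERY INTEGER SEPARATION**: for `m² > 0` and every `z : Fin 1 → ℤ`,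
`S₂^{ℝ}(z) = ∫_{a∈(0,1]^{1}}∫_{b∈(0,1]^{1}} e^{−√m²|z₀+a₀−b₀|}∕(2√m²)db da` — the unit-interval block average of the Ornstein–Uhlenbeck covariance (part Ϸ-q had `z ≥ 1`; here also
`z = 0` and `z ≤ −1`). [cite: King1986, Thm 2.1 (2.22) p.654, (4.5) p.670, (4.36) p.674] -/
theorem kingS2Inf_dim_one_eq_blockAverage_ou {m2 : ℝ} (hm : 0 < m2) (z : Fin 1 → ℤ) :
    kingS2Inf m2 z = ∫ a in Set.pi univ (fun _ : Fin 1 => Ioc (0 : ℝ) 1), ∫ b in Set.pi univ (fun _ : Fin 1 => Ioc (0 : ℝ) 1),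
      Real.exp (-(Real.sqrt m2 * |(z 0 : ℝ) + a 0 - b 0|)) / (2 * Real.sqrt m2) := by
  rw [kingS2Inf_eq_blockAverage_freePropRadial hm z]
  refine integral_congr_ae (Eventually.of_forall fun a => integral_congr_ae (Eventually.of_forall fun b => ?_))
  simp only
  rw [freePropRadial_dim_one hm, Fin.sum_univ_one, Real.sqrt_sq_eq_abs, abs_abs]

end Summit.QuantumFields.YangMills.BalabanUVNodes.N15KingModelRung.ProperTime
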